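import Mathlib

/-!
# Static pencils: the definite locus is log-convex (val-sym-lift-p4 g4, GAP-LIFT §11 (P1))

Helper for route `KPlusLogSqLaw`, crux `WeakLifting` (stmt-ValiantsHypothesis-19561), witness-plan stub
`stub_tridiagonalSectorB` (tridiagonal sector).  After the diagonal monomial gauge, a STATIC symmetric
lacunary pencil (one slope class per entry) on a tree-patterned (e.g. tridiagonal) support with a definite
diagonal is `F(x) = diag(α_i x^{c_i}) − A` with `A` a constant symmetric matrix; for tree supports the signs
of `A` can be gauged nonnegative.  This file proves, for every symmetric entrywise-nonnegative `A`, every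
`α_i > 0` and arbitrary REAL exponents `c_i`, that the M-matrix certificates of positive definiteness
INTERPOLATE along `x = a^{1-s} b^{s}`: if `diag(α a^c) − A` and `diag(α b^c) − A` are certified then
`diag(α x^c) − A ≻ 0` for all `s ∈ [0,1]`, hence `det F` has no zero there.  So the top eigen-branch of a
static definite pencil crosses `0` at most once downwards and once upwards between certified points, for
every size and every exponent vector — a first «no compounding» statement for Jacobi chains with
non-proportional links (GAP-LIFT §10 successor item (a)), and exactly the place where «static» matters
(a binomial diagonal entry already breaks it: GAP-LIFT §11).

Proof (elementary, M-matrix style): a certificate is a positive vector `w` with `A w < d • w`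
componentwise; certificate ⇒ `diag(d) − A ≻ 0` by the AM–GM «Schur test»; certificates interpolate with
`w = u^{1-s} v^{s}` by the weighted AM–GM inequality (Hölder).  No definitions are introduced
(certificates enter as explicit hypotheses).

Honest framing: a structural theorem about real symmetric matrix functions; it says nothing about
`stub_tridiagonalSectorB` in its window, `WeakLifting`, Conjecture B, the census doors,
`MatrixDescartes` (stmt-ValiantsHypothesis-18050) or VP ≠ VNP.
-/

set_option linter.dupNamespace false
set_option autoImplicit false

namespace Summit.ValiantsHypothesis.ValiantsHypothesis.Theorems.KPlusLogSqLaw.StaticDefiniteLocus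

open Matrix Finset

variable {m : Type*} [Fintype m] [DecidableEq m]

/-! An *M-matrix certificate* for `diag(d) − A` is a componentwise positive vector `w` with
`A w < d • w` componentwise; it is passed to the statements below as the two hypotheses
`hw : ∀ i, 0 < w i` and `hc : ∀ i, (A *ᵥ w) i < d i * w i` (no definition is introduced). -/

/-- The quadratic form of `diag(d) − A` written out. -/
theorem dotProduct_diagonal_sub_mulVec (A : Matrix m m ℝ) (d x : m → ℝ) :
    x ⬝ᵥ ((Matrix.diagonal d - A) *ᵥ x) = ∑ i, d i * x i ^ 2 - ∑ i, ∑ j, A i j * x i * x j := by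
  rw [Matrix.sub_mulVec, dotProduct_sub]
  congr 1
  · simp only [dotProduct, mulVec_diagonal]
    exact Finset.sum_congr rfl fun i _ => by ring
  · simp only [dotProduct, mulVec, Finset.mul_sum]
    exact Finset.sum_congr rfl fun i _ => Finset.sum_congr rfl fun j _ => by ring

omit [DecidableEq m] in
/-- AM–GM «Schur test»: for a symmetric entrywise-nonnegative `A` and a positive vector `w`,
`∑_{i,j} A_{ij} x_i x_j ≤ ∑_i (x_i² / w_i) · (A w)_i`. -/
theorem sum_sum_le_of_pos (A : Matrix m m ℝ) (hA : A.IsSymm) (hA0 : ∀ i j, 0 ≤ A i j)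
    {w : m → ℝ} (hw : ∀ i, 0 < w i) (x : m → ℝ) :
    ∑ i, ∑ j, A i j * x i * x j ≤ ∑ i, x i ^ 2 / w i * (A *ᵥ w) i := by
  -- termwise AM–GM: `2 A_ij x_i x_j ≤ A_ij x_i² w_j / w_i + A_ij x_j² w_i / w_j`
  have hterm : ∀ i j, 2 * (A i j * x i * x j) ≤
      A i j * (x i ^ 2 / w i * w j) + A i j * (x j ^ 2 / w j * w i) := by
    intro i j
    have hwi := hw i
    have hwj := hw j
    have key : 2 * (x i * x j) ≤ x i ^ 2 / w i * w j + x j ^ 2 / w j * w i := by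
      rw [div_mul_eq_mul_div, div_mul_eq_mul_div, div_add_div _ _ hwi.ne' hwj.ne',
        le_div_iff₀ (mul_pos hwi hwj)]
      nlinarith [sq_nonneg (x i * w j - x j * w i), hwi, hwj]
    nlinarith [hA0 i j, key]
  have h2 : 2 * ∑ i, ∑ j, A i j * x i * x j ≤
      ∑ i, ∑ j, A i j * (x i ^ 2 / w i * w j) + ∑ i, ∑ j, A i j * (x j ^ 2 / w j * w i) := by
    rw [Finset.mul_sum, ← Finset.sum_add_distrib]
    refine Finset.sum_le_sum fun i _ => ?_
    rw [Finset.mul_sum, ← Finset.sum_add_distrib]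
    exact Finset.sum_le_sum fun j _ => hterm i j
  -- the two double sums coincide by symmetry of `A`
  have hsymm : ∑ i, ∑ j, A i j * (x j ^ 2 / w j * w i) = ∑ i, ∑ j, A i j * (x i ^ 2 / w i * w j) := by
    rw [Finset.sum_comm]
    exact Finset.sum_congr rfl fun i _ => Finset.sum_congr rfl fun j _ => by rw [hA.apply j i]
  have hT : ∑ i, ∑ j, A i j * (x i ^ 2 / w i * w j) = ∑ i, x i ^ 2 / w i * (A *ᵥ w) i := by
    refine Finset.sum_congr rfl fun i _ => ?_
    simp only [mulVec, dotProduct, Finset.mul_sum]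
    exact Finset.sum_congr rfl fun j _ => by ring
  linarith

/-- Certificate ⇒ positive definite. -/
theorem posDef_of_cert {A : Matrix m m ℝ} (hA : A.IsSymm) (hA0 : ∀ i j, 0 ≤ A i j) {d w : m → ℝ}
    (hw : ∀ i, 0 < w i) (hc : ∀ i, (A *ᵥ w) i < d i * w i) : (Matrix.diagonal d - A).PosDef := by
  refine PosDef.of_dotProduct_mulVec_pos ?_ fun x hx => ?_
  · -- Hermitian = symmetric over ℝ
    have h1 : (Matrix.diagonal d - A)ᵀ = Matrix.diagonal d - A := by
      rw [transpose_sub, diagonal_transpose, hA]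
    simpa [Matrix.IsHermitian, conjTranspose_eq_transpose_of_trivial] using h1
  · have hstar : star x = x := funext fun i => by simp
    rw [hstar, dotProduct_diagonal_sub_mulVec]
    obtain ⟨i₀, hi₀⟩ : ∃ i, x i ≠ 0 := Function.ne_iff.mp hx
    have hle := sum_sum_le_of_pos A hA hA0 hw x
    have hlt : ∑ i, x i ^ 2 / w i * (A *ᵥ w) i < ∑ i, d i * x i ^ 2 := by
      apply Finset.sum_lt_sum
      · intro i _
        have hwi := hw i
        have h0 : 0 ≤ x i ^ 2 / w i := div_nonneg (sq_nonneg _) hwi.le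
        calc x i ^ 2 / w i * (A *ᵥ w) i ≤ x i ^ 2 / w i * (d i * w i) :=
              mul_le_mul_of_nonneg_left (hc i).le h0
          _ = d i * x i ^ 2 := by field_simp
      · refine ⟨i₀, Finset.mem_univ _, ?_⟩
        have hwi := hw i₀
        have h0 : 0 < x i₀ ^ 2 / w i₀ := div_pos (by positivity) hwi
        calc x i₀ ^ 2 / w i₀ * (A *ᵥ w) i₀ < x i₀ ^ 2 / w i₀ * (d i₀ * w i₀) :=
              mul_lt_mul_of_pos_left (hc i₀) h0
          _ = d i₀ * x i₀ ^ 2 := by field_simp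
    linarith

/-- Weighted AM–GM in the form used for Hölder: for `U, V > 0` with `U = ∑_j p_j u_j`, `V = ∑_j p_j v_j`
(`p, u, v ≥ 0`), `∑_j p_j u_j^{1-s} v_j^{s} ≤ U^{1-s} V^{s}`. -/
theorem sum_rpow_mul_rpow_le {ι : Type*} (S : Finset ι) (p u v : ι → ℝ) (hp : ∀ j ∈ S, 0 ≤ p j)
    (hu : ∀ j ∈ S, 0 ≤ u j) (hv : ∀ j ∈ S, 0 ≤ v j) {s : ℝ} (hs0 : 0 ≤ s) (hs1 : s ≤ 1)
    {U V : ℝ} (hU : 0 < U) (hV : 0 < V) (hUe : ∑ j ∈ S, p j * u j = U) (hVe : ∑ j ∈ S, p j * v j = V) :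
    ∑ j ∈ S, p j * (u j ^ (1 - s) * v j ^ s) ≤ U ^ (1 - s) * V ^ s := by
  have hUV : 0 < U ^ (1 - s) * V ^ s := mul_pos (Real.rpow_pos_of_pos hU _) (Real.rpow_pos_of_pos hV _)
  -- normalise: `(u_j/U)^{1-s} (v_j/V)^s ≤ (1-s) u_j/U + s v_j/V`
  have hj : ∀ j ∈ S, p j * (u j ^ (1 - s) * v j ^ s) ≤
      U ^ (1 - s) * V ^ s * (p j * ((1 - s) * (u j / U) + s * (v j / V))) := by
    intro j hjS
    have h1 : (u j / U) ^ (1 - s) * (v j / V) ^ s ≤ (1 - s) * (u j / U) + s * (v j / V) :=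
      Real.geom_mean_le_arith_mean2_weighted (by linarith) hs0 (div_nonneg (hu j hjS) hU.le)
        (div_nonneg (hv j hjS) hV.le) (by ring)
    have h2 : (u j / U) ^ (1 - s) * (v j / V) ^ s = u j ^ (1 - s) * v j ^ s / (U ^ (1 - s) * V ^ s) := by
      rw [Real.div_rpow (hu j hjS) hU.le, Real.div_rpow (hv j hjS) hV.le]
      field_simp
    rw [h2, div_le_iff₀ hUV] at h1
    have := mul_le_mul_of_nonneg_left h1 (hp j hjS)
    nlinarith [this]
  calc ∑ j ∈ S, p j * (u j ^ (1 - s) * v j ^ s)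
      ≤ ∑ j ∈ S, U ^ (1 - s) * V ^ s * (p j * ((1 - s) * (u j / U) + s * (v j / V))) :=
        Finset.sum_le_sum hj
    _ = U ^ (1 - s) * V ^ s * ((1 - s) / U * (∑ j ∈ S, p j * u j) + s / V * (∑ j ∈ S, p j * v j)) := by
        rw [← Finset.mul_sum]
        congr 1
        rw [Finset.mul_sum, Finset.mul_sum, ← Finset.sum_add_distrib]
        exact Finset.sum_congr rfl fun j _ => by ring
    _ = U ^ (1 - s) * V ^ s := by
        rw [hUe, hVe]
        field_simp
        ring

omit [DecidableEq m] in
/-- Certificates interpolate geometrically (Hölder): certificates at `a` and `b` for the diagonal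
`α_i x^{c_i}` give a certificate at `x = a^{1-s} b^{s}`, `s ∈ [0,1]`, with `w = u^{1-s} v^{s}`. -/
theorem cert_interpolate {A : Matrix m m ℝ} (hA0 : ∀ i j, 0 ≤ A i j) {α c : m → ℝ}
    (hα : ∀ i, 0 < α i) {a b : ℝ} (ha : 0 < a) (hb : 0 < b) {u v : m → ℝ}
    (hu1 : ∀ i, 0 < u i) (hu2 : ∀ i, (A *ᵥ u) i < α i * a ^ (c i) * u i)
    (hv1 : ∀ i, 0 < v i) (hv2 : ∀ i, (A *ᵥ v) i < α i * b ^ (c i) * v i)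
    {s : ℝ} (hs0 : 0 ≤ s) (hs1 : s ≤ 1) :
    (∀ i, 0 < u i ^ (1 - s) * v i ^ s) ∧
      ∀ i, (A *ᵥ fun j => u j ^ (1 - s) * v j ^ s) i <
        α i * (a ^ (1 - s) * b ^ s) ^ (c i) * (u i ^ (1 - s) * v i ^ s) := by
  refine ⟨fun i => mul_pos (Real.rpow_pos_of_pos (hu1 i) _) (Real.rpow_pos_of_pos (hv1 i) _),
    fun i => ?_⟩
  set U := (A *ᵥ u) i with hUdef
  set V := (A *ᵥ v) i with hVdef
  have hUsum : U = ∑ j, A i j * u j := by rw [hUdef]; simp [mulVec, dotProduct]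
  have hVsum : V = ∑ j, A i j * v j := by rw [hVdef]; simp [mulVec, dotProduct]
  have hU0 : 0 ≤ U := by
    rw [hUsum]; exact Finset.sum_nonneg fun j _ => mul_nonneg (hA0 i j) (hu1 j).le
  have hV0 : 0 ≤ V := by
    rw [hVsum]; exact Finset.sum_nonneg fun j _ => mul_nonneg (hA0 i j) (hv1 j).le
  have hUlt : U < α i * a ^ (c i) * u i := hu2 i
  have hVlt : V < α i * b ^ (c i) * v i := hv2 i
  have hU' : 0 < α i * a ^ (c i) * u i := mul_pos (mul_pos (hα i) (Real.rpow_pos_of_pos ha _)) (hu1 i)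
  have hV' : 0 < α i * b ^ (c i) * v i := mul_pos (mul_pos (hα i) (Real.rpow_pos_of_pos hb _)) (hv1 i)
  -- the target right-hand side equals `(α a^c u)^{1-s} (α b^c v)^s`
  have hαi := (hα i).le
  have hac : 0 ≤ a ^ c i := Real.rpow_nonneg ha.le _
  have hbc : 0 ≤ b ^ c i := Real.rpow_nonneg hb.le _
  have h_i : (a ^ (1 - s) * b ^ s) ^ (c i) = (a ^ c i) ^ (1 - s) * (b ^ c i) ^ s := by
    rw [Real.mul_rpow (Real.rpow_nonneg ha.le _) (Real.rpow_nonneg hb.le _), ← Real.rpow_mul ha.le,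
      ← Real.rpow_mul hb.le, mul_comm (1 - s) (c i), mul_comm s (c i), Real.rpow_mul ha.le,
      Real.rpow_mul hb.le]
  have h_ii : α i = α i ^ (1 - s) * α i ^ s := by
    rw [← Real.rpow_add (hα i), sub_add_cancel, Real.rpow_one]
  have h_iii : (α i * a ^ c i * u i) ^ (1 - s) = α i ^ (1 - s) * (a ^ c i) ^ (1 - s) * u i ^ (1 - s) := by
    rw [Real.mul_rpow (mul_nonneg hαi hac) (hu1 i).le, Real.mul_rpow hαi hac]
  have h_iv : (α i * b ^ c i * v i) ^ s = α i ^ s * (b ^ c i) ^ s * v i ^ s := by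
    rw [Real.mul_rpow (mul_nonneg hαi hbc) (hv1 i).le, Real.mul_rpow hαi hbc]
  have hrhs : α i * (a ^ (1 - s) * b ^ s) ^ (c i) * (u i ^ (1 - s) * v i ^ s) =
      (α i * a ^ (c i) * u i) ^ (1 - s) * (α i * b ^ (c i) * v i) ^ s := by
    rw [h_iii, h_iv, h_i]
    conv_lhs => rw [h_ii]
    ring
  -- main computation: `(A w)_i ≤ U^{1-s} V^s < (α a^c u)^{1-s} (α b^c v)^s`
  have hAw : (A *ᵥ fun j => u j ^ (1 - s) * v j ^ s) i = ∑ j, A i j * (u j ^ (1 - s) * v j ^ s) := by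
    simp [mulVec, dotProduct]
  rw [hAw, hrhs]
  -- strict comparison of the geometric means
  have hstep2 : U ^ (1 - s) * V ^ s < (α i * a ^ (c i) * u i) ^ (1 - s) * (α i * b ^ (c i) * v i) ^ s := by
    rcases eq_or_lt_of_le hs1 with h1 | h1
    · subst h1
      simp only [sub_self, Real.rpow_zero, one_mul, Real.rpow_one]
      exact hVlt
    · have hlt1 : U ^ (1 - s) < (α i * a ^ (c i) * u i) ^ (1 - s) :=
        Real.rpow_lt_rpow hU0 hUlt (by linarith)
      have hle2 : V ^ s ≤ (α i * b ^ (c i) * v i) ^ s := Real.rpow_le_rpow hV0 hVlt.le hs0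
      calc U ^ (1 - s) * V ^ s ≤ U ^ (1 - s) * (α i * b ^ (c i) * v i) ^ s :=
            mul_le_mul_of_nonneg_left hle2 (Real.rpow_nonneg hU0 _)
        _ < (α i * a ^ (c i) * u i) ^ (1 - s) * (α i * b ^ (c i) * v i) ^ s :=
            mul_lt_mul_of_pos_right hlt1 (Real.rpow_pos_of_pos hV' _)
  -- if a row of `A` vanishes the left-hand side is `0`
  have hzero : (∀ j, A i j = 0) →
      ∑ j, A i j * (u j ^ (1 - s) * v j ^ s) < (α i * a ^ (c i) * u i) ^ (1 - s) * (α i * b ^ (c i) * v i) ^ s := by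
    intro hrow
    have : ∑ j, A i j * (u j ^ (1 - s) * v j ^ s) = 0 :=
      Finset.sum_eq_zero fun j _ => by rw [hrow j]; ring
    rw [this]
    exact mul_pos (Real.rpow_pos_of_pos hU' _) (Real.rpow_pos_of_pos hV' _)
  -- Hölder step (or triviality when a row of `A` vanishes)
  rcases eq_or_lt_of_le hU0 with hU | hU
  · refine hzero fun j => ?_
    have hsum : ∑ j, A i j * u j = 0 := by rw [← hUsum]; exact hU.symm
    have := (Finset.sum_eq_zero_iff_of_nonneg fun j _ => mul_nonneg (hA0 i j) (hu1 j).le).mp hsum j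
      (Finset.mem_univ _)
    rcases mul_eq_zero.mp this with h | h
    · exact h
    · exact absurd h (hu1 j).ne'
  rcases eq_or_lt_of_le hV0 with hV | hV
  · refine hzero fun j => ?_
    have hsum : ∑ j, A i j * v j = 0 := by rw [← hVsum]; exact hV.symm
    have := (Finset.sum_eq_zero_iff_of_nonneg fun j _ => mul_nonneg (hA0 i j) (hv1 j).le).mp hsum j
      (Finset.mem_univ _)
    rcases mul_eq_zero.mp this with h | h
    · exact h
    · exact absurd h (hv1 j).ne'
  have hstep1 : ∑ j, A i j * (u j ^ (1 - s) * v j ^ s) ≤ U ^ (1 - s) * V ^ s :=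
    sum_rpow_mul_rpow_le Finset.univ (fun j => A i j) u v (fun j _ => hA0 i j) (fun j _ => (hu1 j).le)
      (fun j _ => (hv1 j).le) hs0 hs1 hU hV hUsum.symm hVsum.symm
  exact lt_of_le_of_lt hstep1 hstep2

/-- **The definite locus of a static pencil is log-convex (certificate form).**  If `diag(α a^{c}) − A`
and `diag(α b^{c}) − A` carry M-matrix certificates then `diag(α x^{c}) − A` is positive definite at every
`x = a^{1-s} b^{s}`, `s ∈ [0,1]`. -/
theorem posDef_rpow_interpolate {A : Matrix m m ℝ} (hA : A.IsSymm) (hA0 : ∀ i j, 0 ≤ A i j)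
    {α c : m → ℝ} (hα : ∀ i, 0 < α i) {a b : ℝ} (ha : 0 < a) (hb : 0 < b) {u v : m → ℝ}
    (hu1 : ∀ i, 0 < u i) (hu2 : ∀ i, (A *ᵥ u) i < α i * a ^ (c i) * u i)
    (hv1 : ∀ i, 0 < v i) (hv2 : ∀ i, (A *ᵥ v) i < α i * b ^ (c i) * v i)
    {s : ℝ} (hs0 : 0 ≤ s) (hs1 : s ≤ 1) :
    (Matrix.diagonal (fun i => α i * (a ^ (1 - s) * b ^ s) ^ (c i)) - A).PosDef :=
  have h := cert_interpolate hA0 hα ha hb hu1 hu2 hv1 hv2 hs0 hs1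
  posDef_of_cert hA hA0 h.1 h.2

/-- Corollary: no zero of the determinant between two certified points. -/
theorem det_ne_zero_rpow_interpolate {A : Matrix m m ℝ} (hA : A.IsSymm) (hA0 : ∀ i j, 0 ≤ A i j)
    {α c : m → ℝ} (hα : ∀ i, 0 < α i) {a b : ℝ} (ha : 0 < a) (hb : 0 < b) {u v : m → ℝ}
    (hu1 : ∀ i, 0 < u i) (hu2 : ∀ i, (A *ᵥ u) i < α i * a ^ (c i) * u i)
    (hv1 : ∀ i, 0 < v i) (hv2 : ∀ i, (A *ᵥ v) i < α i * b ^ (c i) * v i)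
    {s : ℝ} (hs0 : 0 ≤ s) (hs1 : s ≤ 1) :
    (Matrix.diagonal (fun i => α i * (a ^ (1 - s) * b ^ s) ^ (c i)) - A).det ≠ 0 :=
  (posDef_rpow_interpolate hA hA0 hα ha hb hu1 hu2 hv1 hv2 hs0 hs1).det_pos.ne'

/-! ### The converse (positive definite ⇒ certificate) and the certificate-free headline -/

omit [DecidableEq m] in
/-- For a symmetric matrix, the bilinear form is symmetric. -/
theorem dotProduct_mulVec_comm_of_isSymm {M : Matrix m m ℝ} (hM : M.IsSymm) (x y : m → ℝ) :
    x ⬝ᵥ (M *ᵥ y) = y ⬝ᵥ (M *ᵥ x) := by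
  rw [dotProduct_mulVec, ← mulVec_transpose, hM, dotProduct_comm]

/-- **Converse.** A positive definite `diag(d) − A` with `A` symmetric and entrywise nonnegative carries an
M-matrix certificate: `w = (diag d − A)⁻¹ 𝟙` is componentwise positive and `A w < d • w`.  (Comparing the
quadratic form at `w` and at `|w|` shows `w = |w|`.) -/
theorem exists_cert_of_posDef {A : Matrix m m ℝ} (hA : A.IsSymm) (hA0 : ∀ i j, 0 ≤ A i j) {d : m → ℝ}
    (hP : (Matrix.diagonal d - A).PosDef) :
    ∃ w : m → ℝ, (∀ i, 0 < w i) ∧ ∀ i, (A *ᵥ w) i < d i * w i := by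
  set M := Matrix.diagonal d - A with hMdef
  have hMsymm : M.IsSymm := by
    show (Matrix.diagonal d - A)ᵀ = Matrix.diagonal d - A
    rw [transpose_sub, diagonal_transpose, hA]
  have hdet : IsUnit M.det := (Matrix.isUnit_iff_isUnit_det _).mp hP.isUnit
  set w : m → ℝ := M⁻¹ *ᵥ (fun _ => (1 : ℝ)) with hwdef
  have hMw : M *ᵥ w = fun _ => 1 := by
    rw [hwdef, Matrix.mulVec_mulVec, Matrix.mul_nonsing_inv _ hdet, Matrix.one_mulVec]
  -- the quadratic form
  have hQ : ∀ z : m → ℝ, z ⬝ᵥ (M *ᵥ z) = ∑ i, d i * z i ^ 2 - ∑ i, ∑ j, A i j * z i * z j :=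
    fun z => dotProduct_diagonal_sub_mulVec A d z
  set w' : m → ℝ := fun i => |w i| with hw'def
  -- (1) Q(|w|) ≤ Q(w)
  have h1 : w' ⬝ᵥ (M *ᵥ w') ≤ w ⬝ᵥ (M *ᵥ w) := by
    rw [hQ, hQ]
    have hsq : ∑ i, d i * w' i ^ 2 = ∑ i, d i * w i ^ 2 :=
      Finset.sum_congr rfl fun i _ => by rw [hw'def]; simp [sq_abs]
    have hAA : ∑ i, ∑ j, A i j * w i * w j ≤ ∑ i, ∑ j, A i j * w' i * w' j := by
      refine Finset.sum_le_sum fun i _ => Finset.sum_le_sum fun j _ => ?_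
      rw [hw'def, mul_assoc, mul_assoc]
      exact mul_le_mul_of_nonneg_left (by rw [← abs_mul]; exact le_abs_self _) (hA0 i j)
    linarith
  -- (2) the values of the form against `w`
  have hww : w ⬝ᵥ (M *ᵥ w) = ∑ i, w i := by rw [hMw]; simp [dotProduct]
  have hw'w : w' ⬝ᵥ (M *ᵥ w) = ∑ i, |w i| := by rw [hMw]; simp [dotProduct, hw'def]
  -- (3) Q(w' − w) ≤ 0, hence w' = w by positive definiteness
  have h3 : (w' - w) ⬝ᵥ (M *ᵥ (w' - w)) ≤ 0 := by
    have hexp : (w' - w) ⬝ᵥ (M *ᵥ (w' - w)) =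
        w' ⬝ᵥ (M *ᵥ w') - 2 * (w' ⬝ᵥ (M *ᵥ w)) + w ⬝ᵥ (M *ᵥ w) := by
      rw [mulVec_sub, dotProduct_sub, sub_dotProduct, sub_dotProduct,
        dotProduct_mulVec_comm_of_isSymm hMsymm w w']
      ring
    rw [hexp, hw'w, hww]
    have hle : ∑ i, w i ≤ ∑ i, |w i| := Finset.sum_le_sum fun i _ => le_abs_self _
    linarith [h1, hww]
  have hw'eq : w' = w := by
    by_contra hne
    have hne' : w' - w ≠ 0 := sub_ne_zero.mpr hne
    have hpos := hP.dotProduct_mulVec_pos hne'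
    have hstar : star (w' - w) = w' - w := funext fun i => by simp
    rw [hstar] at hpos
    linarith
  have hwnn : ∀ i, 0 ≤ w i := fun i => by
    have := congrFun hw'eq i
    simp only [hw'def] at this
    rw [← this]; exact abs_nonneg _
  -- (4) read off the certificate from `M w = 𝟙`
  have hrow : ∀ i, d i * w i - (A *ᵥ w) i = 1 := by
    intro i
    have := congrFun hMw i
    rw [hMdef, sub_mulVec, Pi.sub_apply, mulVec_diagonal] at this
    exact this
  have hAw : ∀ i, 0 ≤ (A *ᵥ w) i := fun i => by
    simp only [mulVec, dotProduct]
    exact Finset.sum_nonneg fun j _ => mul_nonneg (hA0 i j) (hwnn j)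
  refine ⟨w, fun i => ?_, fun i => by linarith [hrow i]⟩
  have hdw : 0 < d i * w i := by linarith [hrow i, hAw i]
  rcases (hwnn i).lt_or_eq with h | h
  · exact h
  · rw [← h, mul_zero] at hdw; exact absurd hdw (lt_irrefl _)

/-- Every point of `[a,b]` (`0 < a ≤ b`) is a geometric interpolation `a^{1-s} b^{s}`, `s ∈ [0,1]`. -/
theorem exists_rpow_interpolation {a b x : ℝ} (ha : 0 < a) (hab : a ≤ b) (hx : x ∈ Set.Icc a b) :
    ∃ s : ℝ, 0 ≤ s ∧ s ≤ 1 ∧ a ^ (1 - s) * b ^ s = x := by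
  rcases hab.lt_or_eq with hlt | heq
  · have hb : 0 < b := ha.trans hlt
    have hxpos : 0 < x := ha.trans_le hx.1
    have hL : 0 < Real.log (b / a) := Real.log_pos ((one_lt_div ha).mpr hlt)
    refine ⟨Real.log (x / a) / Real.log (b / a), div_nonneg (Real.log_nonneg ((one_le_div ha).mpr hx.1))
      hL.le, (div_le_one hL).mpr (Real.log_le_log (div_pos hxpos ha)
      (div_le_div_of_nonneg_right hx.2 ha.le)), ?_⟩
    set s := Real.log (x / a) / Real.log (b / a) with hsdef
    have hbas : (b / a) ^ s = x / a := by
      rw [Real.rpow_def_of_pos (div_pos hb ha), hsdef, mul_div_cancel₀ _ hL.ne',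
        Real.exp_log (div_pos hxpos ha)]
    calc a ^ (1 - s) * b ^ s = a * (b ^ s / a ^ s) := by
          rw [Real.rpow_sub ha, Real.rpow_one]; ring
      _ = a * (b / a) ^ s := by rw [Real.div_rpow hb.le ha.le]
      _ = x := by rw [hbas]; field_simp
  · subst heq
    have : x = a := le_antisymm hx.2 hx.1
    exact ⟨0, le_rfl, zero_le_one, by rw [this]; simp [Real.rpow_one]⟩

/-- **The definite locus of a static pencil is an interval (certificate-free headline).**  For
`F(x) = diag(α_i x^{c_i}) − A` with `A` symmetric entrywise nonnegative, `α_i > 0`, real `c_i`: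
if `F(a) ≻ 0` and `F(b) ≻ 0` with `0 < a ≤ b`, then `F(x) ≻ 0` for every `x ∈ [a,b]`. -/
theorem posDef_of_mem_Icc {A : Matrix m m ℝ} (hA : A.IsSymm) (hA0 : ∀ i j, 0 ≤ A i j)
    {α c : m → ℝ} (hα : ∀ i, 0 < α i) {a b : ℝ} (ha : 0 < a) (hab : a ≤ b)
    (hPa : (Matrix.diagonal (fun i => α i * a ^ (c i)) - A).PosDef)
    (hPb : (Matrix.diagonal (fun i => α i * b ^ (c i)) - A).PosDef)
    {x : ℝ} (hx : x ∈ Set.Icc a b) :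
    (Matrix.diagonal (fun i => α i * x ^ (c i)) - A).PosDef := by
  obtain ⟨u, hu1, hu2⟩ := exists_cert_of_posDef hA hA0 hPa
  obtain ⟨v, hv1, hv2⟩ := exists_cert_of_posDef hA hA0 hPb
  obtain ⟨s, hs0, hs1, hsx⟩ := exists_rpow_interpolation ha hab hx
  rw [← hsx]
  exact posDef_rpow_interpolate hA hA0 hα ha (ha.trans_le hab) hu1 hu2 hv1 hv2 hs0 hs1

/-- Corollary: `det F` has no zero between two points where `F` is positive definite — the top
eigen-branch of a static definite pencil crosses zero at most once in each direction. -/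
theorem det_ne_zero_of_mem_Icc {A : Matrix m m ℝ} (hA : A.IsSymm) (hA0 : ∀ i j, 0 ≤ A i j)
    {α c : m → ℝ} (hα : ∀ i, 0 < α i) {a b : ℝ} (ha : 0 < a) (hab : a ≤ b)
    (hPa : (Matrix.diagonal (fun i => α i * a ^ (c i)) - A).PosDef)
    (hPb : (Matrix.diagonal (fun i => α i * b ^ (c i)) - A).PosDef)
    {x : ℝ} (hx : x ∈ Set.Icc a b) :
    (Matrix.diagonal (fun i => α i * x ^ (c i)) - A).det ≠ 0 :=
  (posDef_of_mem_Icc hA hA0 hα ha hab hPa hPb hx).det_pos.ne'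

end Summit.ValiantsHypothesis.ValiantsHypothesis.Theorems.KPlusLogSqLaw.StaticDefiniteLocus
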